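import Literature.Geometry.Riemannian.PinchingEstimatesTwoSingular
import Literature.Geometry.Riemannian.PinchingEstimatesSingular
import Literature.Geometry.Riemannian.PositiveCurvatureOperatorBlocks
import HarnessLib

/-!
# Hamilton 1986, Thm. 7.1, inequality (1): `(b₂ + b₃)² ≤ G a₁ c₁` is preserved — proved
(topic `Geometry/Riemannian`)

A brick of the pinching set of **Hamilton 1986, Thm. 7.1** (J. Differential Geom. 24, p. 170),
the finite-dimensional (ODE) layer of the proof of
`Literature.Geometry.Riemannian.hamilton_positiveCurvatureOperator_classification_four`
(`HamiltonPCOClassification.lean`; see the table in `HamiltonPCOClassificationProofs.lean`).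
Hamilton, p. 171: "We see immediately that `d/dt log [(b₂ + b₃)² / a₁c₁] ≤ …` [a non-positive
quantity, by Lemma 7.2, i.e. Lemma 6.1 rewritten logarithmically] and hence the inequality
`(b₂ + b₃)² ≤ G a₁ c₁` is preserved for any constant `G`." Here `a₁ ≤ a₂ ≤ a₃`, `c₁ ≤ c₂ ≤ c₃`
are the eigenvalues of the symmetric blocks `A`, `C` and `0 ≤ b₁ ≤ b₂ ≤ b₃` the singular values
of `B` in the curvature operator `M = (A B; ᵗB C)` of a 4-manifold, evolving by Hamilton's ODE
`HamiltonODE.field` (`A' = A² + BᵗB + 2A#`, `B' = AB + BC + 2B#`, `C' = C² + ᵗBB + 2C#`;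
Hamilton 1986, §6, p. 166).

PROVED here at the ODE level, in the tree's closed variational language
(`HamiltonODE.IsInvariantRel`, `HamiltonCurvatureODE.lean`; compare the 1997 analogue
`hamilton1997_B13_ode`, `(b₂ + b₃)² ≤ Λ(a₁ + a₂)(c₁ + c₂)`, in `PinchingEstimatesTwoSingular.lean`,
whose frame-normalisation lemmas are reused):

* `SingularValuesSumSqLEMinProd p G` — the closed set `{(b₂ + b₃)² ≤ G a₁ c₁}`: for all
  orthonormal pairs `(u₁, u₂)`, `(v₁, v₂)` and unit `w`, `z`,
  `(u₁ᵀBv₁ + u₂ᵀBv₂)² ≤ G (wᵀAw)(zᵀCz)` (Ky Fan: `b₂ + b₃ = max u₁ᵀBv₁ + u₂ᵀBv₂`;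
  `a₁ = min wᵀAw`, `c₁ = min zᵀCz`, Hamilton p. 167).
* `hamilton1986_pinchingOne_ode` — for `0 < m` and `0 < G` this set is forward invariant under
  Hamilton's ODE relative to `{A, C symmetric} ∩ {a₁ ≥ m} ∩ {c₁ ≥ m}`
  (`Matrix.SmallestEigenvalueAddNonneg · (-m)`), which is exactly what the printed argument
  uses (`a₁, c₁ > 0` to take logarithms; p. 171, "so we can assume `0 < a₁ ≤ a₂ ≤ a₃`, …").
* `hamilton1986_pinchingOne_ode_of_operatorGE` — the same relative to
  `{A, C symmetric} ∩ {M ≥ m}` (`HamiltonODE.OperatorGE`, the form in which Thm. 7.1 is used: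
  `M ≥ m > 0` is itself preserved, `isInvariant_isSymm_operatorGE`, `HamiltonODEPositiveCone.lean`).

Proof: the barrier lemma `minOverSet_nonneg_of_deriv` (`HamiltonODEMinBarrier.lean`, Hamilton
1986 Lemma 3.1/3.5) for `𝒢 = G (wᵀAw)(zᵀCz) - Y(U, V)²` over `pairSet² × unitSet²`; at a
minimiser with `𝒢 ≤ 0`, `w` and `z` minimise the Rayleigh quotients (`a₁`, `c₁`), the frames
maximise `|Y|` (`b₂ + b₃`) and are rotated to a diagonal maximiser (`exists_diag_maximiser`);
then Lemma 6.1 in the tree's pointwise forms — `Y' ≤ (a₃ + c₃ + 2b₁) Y` (`kyFanMax_upper`),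
`a₁' ≥ 2a₁(a₃ + b₁)` (`rayleighMin_lower`, from `a₁' ≥ a₁² + b₁² + 2a₂a₃`), the same for `c₁` —
give `𝒢' ≥ S · 𝒢` with `0 ≤ S ≤ 8R` bounded along the solution (`twoSingular_scalar`).
No new named facts (D-0026): everything below is a definition with a body or a proved theorem.

## References

* R. S. Hamilton, *Four-manifolds with positive curvature operator*, J. Differential Geom. 24
  (1986) 153–179: §6, p. 167 (variational characterisations), Lemma 6.1 (p. 167), §7, Thm. 7.1
  (p. 170), Lemma 7.2 and the proof of (1) (p. 171). [Hamilton1986]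
* R. S. Hamilton, Comm. Anal. Geom. 5 (1997), §2.1, Thm. 1.3 (pp. 7–8) (the analogous estimate
  with `a₁ + a₂`, `c₁ + c₂`). [Hamilton1997]
-/

noncomputable section

open Set Real Filter
open scoped Matrix BigOperators Topology

namespace Literature.Geometry.Riemannian

namespace HamiltonODE

/-! ### The set `{(b₂ + b₃)² ≤ G a₁ c₁}` and the barrier functional -/

/-- **`(b₂ + b₃)² ≤ G a₁ c₁`** (Hamilton 1986, Thm. 7.1, inequality (1)), variationally and in
closed form: for all orthonormal pairs `(u₁, u₂)`, `(v₁, v₂)` and all unit vectors `w`, `z`,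
`(u₁ᵀBv₁ + u₂ᵀBv₂)² ≤ G (wᵀAw)(zᵀCz)` (`b₂ + b₃` is the maximum of the Ky Fan sums,
`a₁ = inf {A(x, x) : |x| = 1}`, `c₁ = inf {C(z, z) : |z| = 1}`, p. 167; on `a₁, c₁ ≥ 0` the
product of the minima is the minimum of the products). [cite: Hamilton1986, §7, Thm. 7.1 (1) (p. 170); §6, p. 167] -/
def SingularValuesSumSqLEMinProd (p : Blocks) (G : ℝ) : Prop :=
  ∀ u₁ u₂ v₁ v₂ w z : Fin 3 → ℝ,
    u₁ ⬝ᵥ u₁ = 1 → u₂ ⬝ᵥ u₂ = 1 → u₁ ⬝ᵥ u₂ = 0 → v₁ ⬝ᵥ v₁ = 1 → v₂ ⬝ᵥ v₂ = 1 → v₁ ⬝ᵥ v₂ = 0 →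
    w ⬝ᵥ w = 1 → z ⬝ᵥ z = 1 →
      (u₁ ⬝ᵥ (p.2.1 *ᵥ v₁) + u₂ ⬝ᵥ (p.2.1 *ᵥ v₂)) ^ 2 ≤
        G * (w ⬝ᵥ (p.1 *ᵥ w)) * (z ⬝ᵥ (p.2.2 *ᵥ z))

/-- The parameter set `pairSet² × unitSet²`, `q = ((U, V), (w, z))`. [folklore] -/
def pcoOneSet : Set (PP × UU) := (pairSet ×ˢ pairSet) ×ˢ (unitSet ×ˢ unitSet)

/-- It is compact. [folklore] -/
theorem isCompact_pcoOneSet : IsCompact pcoOneSet :=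
  (isCompact_pairSet.prod isCompact_pairSet).prod (isCompact_unitSet.prod isCompact_unitSet)

/-- It is nonempty. [folklore] -/
theorem pcoOneSet_nonempty : pcoOneSet.Nonempty :=
  (pairSet_nonempty.prod pairSet_nonempty).prod (unitSet_nonempty.prod unitSet_nonempty)

/-- The barrier functional `𝒢 = G (wᵀAw)(zᵀCz) - Y(U, V)²`. [folklore] -/
def pcoOneG (G : ℝ) (p : Blocks) (q : PP × UU) : ℝ :=
  G * (q.2.1 ⬝ᵥ (p.1 *ᵥ q.2.1)) * (q.2.2 ⬝ᵥ (p.2.2 *ᵥ q.2.2)) - kyFanQ p.2.1 q.1 ^ 2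

/-- Its derivative along a curve with velocity `p'`. [folklore] -/
def pcoOneG' (G : ℝ) (p p' : Blocks) (q : PP × UU) : ℝ :=
  G * ((q.2.1 ⬝ᵥ (p'.1 *ᵥ q.2.1)) * (q.2.2 ⬝ᵥ (p.2.2 *ᵥ q.2.2)) +
      (q.2.1 ⬝ᵥ (p.1 *ᵥ q.2.1)) * (q.2.2 ⬝ᵥ (p'.2.2 *ᵥ q.2.2))) -
    2 * kyFanQ p.2.1 q.1 * kyFanQ p'.2.1 q.1

/-- `(b₂ + b₃)² ≤ G a₁ c₁` iff `𝒢 ≥ 0` on the parameter set. [folklore] -/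
theorem singularValuesSumSqLEMinProd_iff (G : ℝ) (p : Blocks) :
    SingularValuesSumSqLEMinProd p G ↔ ∀ q ∈ pcoOneSet, 0 ≤ pcoOneG G p q := by
  constructor
  · rintro h ⟨⟨⟨u₁, u₂⟩, ⟨v₁, v₂⟩⟩, ⟨w, z⟩⟩ ⟨⟨⟨hu₁, hu₂, hu⟩, ⟨hv₁, hv₂, hv⟩⟩, ⟨hw, hz⟩⟩
    have := h u₁ u₂ v₁ v₂ w z hu₁ hu₂ hu hv₁ hv₂ hv hw hz
    simp only [pcoOneG, kyFanQ]; linarith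
  · intro h u₁ u₂ v₁ v₂ w z hu₁ hu₂ hu hv₁ hv₂ hv hw hz
    have := h (((u₁, u₂), (v₁, v₂)), (w, z)) ⟨⟨⟨hu₁, hu₂, hu⟩, ⟨hv₁, hv₂, hv⟩⟩, ⟨hw, hz⟩⟩
    simp only [pcoOneG, kyFanQ] at this; linarith

/-! ### Calculus and continuity -/

/-- Derivative of `𝒢` along a differentiable curve of blocks. [folklore] -/
theorem hasDerivAt_pcoOneG (G : ℝ) {γ : ℝ → Blocks} {γ' : Blocks} {s : ℝ}
    (hγ : HasDerivAt γ γ' s) (q : PP × UU) :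
    _root_.HasDerivAt (fun t ↦ pcoOneG G (γ t) q) (pcoOneG' G (γ s) γ' q) s := by
  have hX := hasDerivAt_quadForm hγ.1 q.2.1 q.2.1
  have hZ := hasDerivAt_quadForm hγ.2.2 q.2.2 q.2.2
  have hY := hasDerivAt_kyFanQ hγ.2.1 q.1
  have h := ((hX.mul hZ).const_mul G).sub (hY.pow 2)
  have e : (fun t ↦ pcoOneG G (γ t) q) =
      (fun y ↦ G * ((fun t ↦ q.2.1 ⬝ᵥ ((γ t).1 *ᵥ q.2.1)) * fun t ↦ q.2.2 ⬝ᵥ ((γ t).2.2 *ᵥ q.2.2)) y) -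
        (fun t ↦ kyFanQ (γ t).2.1 q.1) ^ 2 := by
    funext t; simp only [pcoOneG, Pi.sub_apply, Pi.mul_apply, Pi.pow_apply]; ring
  rw [e]
  refine h.congr_deriv ?_
  simp only [pcoOneG', Nat.cast_ofNat]
  ring

/-- `(p, p', q) ↦ 𝒢'` is continuous. [folklore] -/
theorem continuous_pcoOneG' (G : ℝ) :
    Continuous fun z : Blocks × Blocks × (PP × UU) ↦ pcoOneG' G z.1 z.2.1 z.2.2 := by
  unfold pcoOneG'
  have hX := continuous_quadForm
  have hY := continuous_kyFanQ'
  have hp : Continuous fun z : Blocks × Blocks × (PP × UU) ↦ z.1 := continuous_fst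
  have hp' : Continuous fun z : Blocks × Blocks × (PP × UU) ↦ z.2.1 := continuous_fst.comp continuous_snd
  have hq : Continuous fun z : Blocks × Blocks × (PP × UU) ↦ z.2.2 := continuous_snd.comp continuous_snd
  have hw := continuous_fst.comp (continuous_snd.comp hq)
  have hz := continuous_snd.comp (continuous_snd.comp hq)
  have hU := continuous_fst.comp hq
  refine (continuous_const.mul (((hX.comp ((continuous_fst.comp hp').prodMk (hw.prodMk hw))).mul
    (hX.comp ((continuous_snd.comp (continuous_snd.comp hp)).prodMk (hz.prodMk hz)))).add
    ((hX.comp ((continuous_fst.comp hp).prodMk (hw.prodMk hw))).mul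
    (hX.comp ((continuous_snd.comp (continuous_snd.comp hp')).prodMk (hz.prodMk hz)))))).sub
    ((continuous_const.mul (hY.comp ((continuous_fst.comp (continuous_snd.comp hp)).prodMk hU))).mul
    (hY.comp ((continuous_fst.comp (continuous_snd.comp hp')).prodMk hU)))

/-- `(p, q) ↦ 𝒢` is continuous. [folklore] -/
theorem continuous_pcoOneG (G : ℝ) :
    Continuous fun z : Blocks × (PP × UU) ↦ pcoOneG G z.1 z.2 := by
  unfold pcoOneG
  have hX := continuous_quadForm
  have hY := continuous_kyFanQ'
  have hp : Continuous fun z : Blocks × (PP × UU) ↦ z.1 := continuous_fst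
  have hq : Continuous fun z : Blocks × (PP × UU) ↦ z.2 := continuous_snd
  have hw := continuous_fst.comp (continuous_snd.comp hq)
  have hz := continuous_snd.comp (continuous_snd.comp hq)
  have hU := continuous_fst.comp hq
  exact ((continuous_const.mul (hX.comp ((continuous_fst.comp hp).prodMk (hw.prodMk hw)))).mul
    (hX.comp ((continuous_snd.comp (continuous_snd.comp hp)).prodMk (hz.prodMk hz)))).sub
    ((hY.comp ((continuous_fst.comp (continuous_snd.comp hp)).prodMk hU)).pow 2)

attribute [local irreducible] pcoOneG in
/-- Joint continuity of `𝒢` along a continuous curve. [folklore] -/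
theorem continuousOn_pcoOneG_family (G : ℝ) {γ : ℝ → Blocks} {S : Set ℝ} (hγ : ContinuousOn γ S)
    (K : Set (PP × UU)) : ContinuousOn (fun z : ℝ × (PP × UU) ↦ pcoOneG G (γ z.1) z.2) (S ×ˢ K) := by
  have h1 : ContinuousOn (fun z : ℝ × (PP × UU) ↦ γ z.1) (S ×ˢ K) :=
    hγ.comp continuousOn_fst fun z hz ↦ (Set.mem_prod.1 hz).1
  exact (continuous_pcoOneG G).continuousOn.comp (h1.prodMk continuousOn_snd) (Set.mapsTo_univ _ _)

attribute [local irreducible] pcoOneG' in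
/-- Joint continuity of `𝒢'` along a continuous solution. [folklore] -/
theorem continuousOn_pcoOneG'_family (G : ℝ) {γ : ℝ → Blocks} {S : Set ℝ} (hγ : ContinuousOn γ S)
    (K : Set (PP × UU)) :
    ContinuousOn (fun z : ℝ × (PP × UU) ↦ pcoOneG' G (γ z.1) (field (γ z.1)) z.2) (S ×ˢ K) := by
  have h1 : ContinuousOn (fun z : ℝ × (PP × UU) ↦ γ z.1) (S ×ˢ K) :=
    hγ.comp continuousOn_fst fun z hz ↦ (Set.mem_prod.1 hz).1
  exact (continuous_pcoOneG' G).continuousOn.comp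
    (h1.prodMk ((continuous_field.comp_continuousOn h1).prodMk continuousOn_snd)) (Set.mapsTo_univ _ _)

/-! ### The sign condition at a minimiser (Hamilton 1986, p. 171) -/

/-- `a₁ ≥ m` gives `a₁ + a₂ ≥ 2m` (variational forms). [folklore] -/
theorem twoSmallestEigenvaluesSumGE_of_smallestEigenvalueAddNonneg {A : Matrix (Fin 3) (Fin 3) ℝ}
    {m : ℝ} (h : A.SmallestEigenvalueAddNonneg (-m)) : A.TwoSmallestEigenvaluesSumGE (2 * m) := by
  intro u v hu hv _
  have h1 := h u hu
  have h2 := h v hv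
  linarith
set_option maxHeartbeats 400000 in -- buildfix (bf3-g27): 160k/180k FAIL, 200k PASS at accept time; line-neutral budget line
/-- **The sign condition at a minimiser of `𝒢`** (pointwise form of Hamilton 1986, p. 171,
`d/dt log [(b₂ + b₃)² / a₁c₁] ≤ 0`): for symmetric `A`, `C` with `a₁, c₁ ≥ m > 0`, `G > 0` and
`R ≥ Σ|A| + Σ|B| + Σ|C|`, if `𝒢 ≤ 0` at a minimiser `q` then `8R · 𝒢(q) ≤ 𝒢'(q)`.
[cite: Hamilton1986, §7, Lemma 7.2 and proof of Thm. 7.1 (1) (p. 171); §6, Lemma 6.1 (p. 167)] -/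
theorem pcoOne_sign {G m R : ℝ} (hG : 0 < G) (hm : 0 < m) {p : Blocks} (hA : p.1.IsSymm)
    (hC : p.2.2.IsSymm) (h1A : p.1.SmallestEigenvalueAddNonneg (-m))
    (h1C : p.2.2.SmallestEigenvalueAddNonneg (-m))
    (hR : (∑ k, ∑ l, |p.1 k l|) + (∑ k, ∑ l, |p.2.1 k l|) + ∑ k, ∑ l, |p.2.2 k l| ≤ R)
    {q : PP × UU} (hq : q ∈ pcoOneSet) (hqmin : IsMinOn (pcoOneG G p) pcoOneSet q)
    (hG0 : pcoOneG G p q ≤ 0) :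
    8 * R * pcoOneG G p q ≤ pcoOneG' G p (field p) q := by
  obtain ⟨F, w, z⟩ := q
  obtain ⟨hF, hw, hz⟩ := hq
  obtain ⟨A, B, C⟩ := p
  simp only at hA hC h1A h1C hR hqmin hG0 ⊢
  have hw1 : w ⬝ᵥ w = 1 := hw
  have hz1 : z ⬝ᵥ z = 1 := hz
  -- positivity of `a₁`, `c₁` at the minimising vectors
  have hX : m ≤ w ⬝ᵥ (A *ᵥ w) := by linarith [h1A w hw1]
  have hXC : m ≤ z ⬝ᵥ (C *ᵥ z) := by linarith [h1C z hz1]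
  have hXpos : 0 < w ⬝ᵥ (A *ᵥ w) := by linarith
  have hXCpos : 0 < z ⬝ᵥ (C *ᵥ z) := by linarith
  -- decoupling
  have hminW : ∀ r ∈ unitSet, w ⬝ᵥ (A *ᵥ w) ≤ r ⬝ᵥ (A *ᵥ r) := by
    intro r hr
    have h := hqmin (show (F, (r, z)) ∈ pcoOneSet from ⟨hF, hr, hz⟩)
    simp only [mem_setOf_eq, pcoOneG] at h
    nlinarith [mul_pos hG hXCpos]
  have hminZ : ∀ r ∈ unitSet, z ⬝ᵥ (C *ᵥ z) ≤ r ⬝ᵥ (C *ᵥ r) := by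
    intro r hr
    have h := hqmin (show (F, (w, r)) ∈ pcoOneSet from ⟨hF, hw, hr⟩)
    simp only [mem_setOf_eq, pcoOneG] at h
    nlinarith [mul_pos hG hXpos]
  have hmaxF : ∀ F' ∈ (pairSet ×ˢ pairSet : Set PP), kyFanQ B F' ^ 2 ≤ kyFanQ B F ^ 2 := by
    intro F' hF'
    have h := hqmin (show (F', (w, z)) ∈ pcoOneSet from ⟨hF', hw, hz⟩)
    simp only [mem_setOf_eq, pcoOneG] at h
    linarith
  -- flip to a non-negative maximiser, then rotate to a diagonal one
  obtain ⟨Fb, hFb, hYnn, hflip⟩ : ∃ Fb ∈ (pairSet ×ˢ pairSet : Set PP), 0 ≤ kyFanQ B Fb ∧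
      ∃ σ : ℝ, σ ^ 2 = 1 ∧ ∀ X : Matrix (Fin 3) (Fin 3) ℝ, kyFanQ X Fb = σ * kyFanQ X F := by
    rcases le_or_gt 0 (kyFanQ B F) with h | h
    · exact ⟨F, hF, h, 1, by norm_num, fun X ↦ by ring⟩
    · exact ⟨_, flip_mem hF, by rw [kyFanQ_flip]; linarith, -1, by norm_num, fun X ↦ by rw [kyFanQ_flip]; ring⟩
  obtain ⟨σ, hσ, hσX⟩ := hflip
  have hmaxb : ∀ F' ∈ (pairSet ×ˢ pairSet : Set PP), kyFanQ B F' ≤ kyFanQ B Fb := by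
    intro F' hF'
    have h1 := hmaxF F' hF'
    have h2 : kyFanQ B Fb ^ 2 = kyFanQ B F ^ 2 := by rw [hσX B, mul_pow, hσ, one_mul]
    rw [← h2] at h1
    nlinarith [abs_le_abs (le_abs_self (kyFanQ B F')) (neg_le_abs _), sq_abs (kyFanQ B F'),
      abs_nonneg (kyFanQ B F')]
  obtain ⟨F₀, hF₀, hF₀X, hdiag⟩ := exists_diag_maximiser hFb hmaxb
  obtain ⟨⟨u₁, u₂⟩, ⟨v₁, v₂⟩⟩ := F₀
  obtain ⟨⟨hu₁, hu₂, hu⟩, ⟨hv₁, hv₂, hv⟩⟩ := hF₀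
  simp only at hdiag hF₀X
  have hmax₀ : ∀ u₁' u₂' v₁' v₂' : Fin 3 → ℝ, u₁' ⬝ᵥ u₁' = 1 → u₂' ⬝ᵥ u₂' = 1 → u₁' ⬝ᵥ u₂' = 0 →
      v₁' ⬝ᵥ v₁' = 1 → v₂' ⬝ᵥ v₂' = 1 → v₁' ⬝ᵥ v₂' = 0 →
      u₁' ⬝ᵥ (B *ᵥ v₁') + u₂' ⬝ᵥ (B *ᵥ v₂') ≤ u₁ ⬝ᵥ (B *ᵥ v₁) + u₂ ⬝ᵥ (B *ᵥ v₂) := by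
    intro u₁' u₂' v₁' v₂' a b c d e f
    have h := hmaxb ((u₁', u₂'), (v₁', v₂')) ⟨⟨a, b, c⟩, ⟨d, e, f⟩⟩
    rw [← hF₀X B] at h
    exact h
  -- the values `Y₀ = |Y| ≥ 0` and `Y₀ Y₀' = Y Y'`
  have hY0 : 0 ≤ u₁ ⬝ᵥ (B *ᵥ v₁) + u₂ ⬝ᵥ (B *ᵥ v₂) := by
    have h1 : u₁ ⬝ᵥ (B *ᵥ v₁) + u₂ ⬝ᵥ (B *ᵥ v₂) = kyFanQ B Fb := hF₀X B
    rw [h1]; exact hYnn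
  have hYY : ∀ X : Matrix (Fin 3) (Fin 3) ℝ,
      (u₁ ⬝ᵥ (B *ᵥ v₁) + u₂ ⬝ᵥ (B *ᵥ v₂)) * (u₁ ⬝ᵥ (X *ᵥ v₁) + u₂ ⬝ᵥ (X *ᵥ v₂)) =
        kyFanQ B F * kyFanQ X F := by
    intro X
    have h1 : u₁ ⬝ᵥ (B *ᵥ v₁) + u₂ ⬝ᵥ (B *ᵥ v₂) = σ * kyFanQ B F := (hF₀X B).trans (hσX B)
    have h2 : u₁ ⬝ᵥ (X *ᵥ v₁) + u₂ ⬝ᵥ (X *ᵥ v₂) = σ * kyFanQ X F := (hF₀X X).trans (hσX X)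
    rw [h1, h2]
    linear_combination (kyFanQ B F * kyFanQ X F) * hσ
  have hY2 : (u₁ ⬝ᵥ (B *ᵥ v₁) + u₂ ⬝ᵥ (B *ᵥ v₂)) ^ 2 = kyFanQ B F ^ 2 := by rw [sq, hYY B, sq]
  -- maximisers of the Rayleigh quotients (`a₃`, `c₃`)
  obtain ⟨u₃, hu₃, hMA⟩ := exists_rayleigh_max A
  obtain ⟨z₃, hz₃, hMC⟩ := exists_rayleigh_max C
  have hMA' : ∀ e : Fin 3 → ℝ, e ⬝ᵥ e = 1 → e ⬝ᵥ (A *ᵥ e) ≤ u₃ ⬝ᵥ (A *ᵥ u₃) := fun e he ↦ hMA e he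
  have hMC' : ∀ e : Fin 3 → ℝ, e ⬝ᵥ e = 1 → e ⬝ᵥ (C *ᵥ e) ≤ z₃ ⬝ᵥ (C *ᵥ z₃) := fun e he ↦ hMC e he
  -- `κ` and the three differential bounds (Lemma 6.1)
  set κ := (u₁ ⨯₃ u₂) ⬝ᵥ (B *ᵥ (v₁ ⨯₃ v₂)) with hκ
  have hup := kyFanMax_upper (A := A) (C := C) hu₁ hu₂ hu hv₁ hv₂ hv hmax₀ hdiag hMA' hMC'
  have hkw := normSq_transpose_ge_kappa_sq hu₁ hu₂ hu hv₁ hv₂ hv hmax₀ hdiag w hw1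
  have hkz := normSq_ge_kappa_sq hu₁ hu₂ hu hv₁ hv₂ hv hmax₀ hdiag z hz1
  have h12A := twoSmallestEigenvaluesSumGE_of_smallestEigenvalueAddNonneg h1A
  have h12C := twoSmallestEigenvaluesSumGE_of_smallestEigenvalueAddNonneg h1C
  have hm2 : 0 < 2 * m := by positivity
  have hlowA := rayleighMin_lower (B := B) hA hm2 h12A hw1 hu₃ hminW hMA
  have hlowC := rayleighMin_lower (B := Bᵀ) hC hm2 h12C hz1 hz₃ hminZ hMC
  rw [Matrix.transpose_transpose] at hlowC
  have hκw : |κ| ≤ ((Bᵀ *ᵥ w) ⬝ᵥ (Bᵀ *ᵥ w)).sqrt := Real.abs_le_sqrt hkw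
  have hκz : |κ| ≤ ((B *ᵥ z) ⬝ᵥ (B *ᵥ z)).sqrt := Real.abs_le_sqrt hkz
  have hX' : 2 * (u₃ ⬝ᵥ (A *ᵥ u₃) + |κ|) * (w ⬝ᵥ (A *ᵥ w)) ≤
      w ⬝ᵥ ((A * A + B * Bᵀ + (2 : ℝ) • A.sharp) *ᵥ w) := by
    refine le_trans ?_ hlowA
    nlinarith [mul_le_mul_of_nonneg_left hκw hXpos.le]
  have hXC' : 2 * (z₃ ⬝ᵥ (C *ᵥ z₃) + |κ|) * (z ⬝ᵥ (C *ᵥ z)) ≤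
      z ⬝ᵥ ((C * C + Bᵀ * B + (2 : ℝ) • C.sharp) *ᵥ z) := by
    refine le_trans ?_ hlowC
    nlinarith [mul_le_mul_of_nonneg_left hκz hXCpos.le]
  -- bookkeeping
  have key := twoSingular_scalar (Λ := G) (X := w ⬝ᵥ (A *ᵥ w)) (XC := z ⬝ᵥ (C *ᵥ z)) hG.le
    hXpos.le hXCpos.le hY0 hup hX' hXC'
  -- compare constants
  have hAnn : 0 ≤ ∑ k, ∑ l, |A k l| := Finset.sum_nonneg fun k _ ↦ Finset.sum_nonneg fun l _ ↦ abs_nonneg (A k l)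
  have hBnn : 0 ≤ ∑ k, ∑ l, |B k l| := Finset.sum_nonneg fun k _ ↦ Finset.sum_nonneg fun l _ ↦ abs_nonneg (B k l)
  have hCnn : 0 ≤ ∑ k, ∑ l, |C k l| := Finset.sum_nonneg fun k _ ↦ Finset.sum_nonneg fun l _ ↦ abs_nonneg (C k l)
  have hκR : |κ| ≤ R := by
    have h1 := abs_bilin_le_sum B (dotProduct_cross_self_of_orthonormal hu₁ hu₂ hu)
      (dotProduct_cross_self_of_orthonormal hv₁ hv₂ hv)
    linarith
  have hMAR : u₃ ⬝ᵥ (A *ᵥ u₃) ≤ R := by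
    have h1 := (abs_le.1 (abs_quad_le_sum A (show u₃ ⬝ᵥ u₃ = 1 from hu₃))).2
    linarith
  have hMCR : z₃ ⬝ᵥ (C *ᵥ z₃) ≤ R := by
    have h1 := (abs_le.1 (abs_quad_le_sum C (show z₃ ⬝ᵥ z₃ = 1 from hz₃))).2
    linarith
  have hS : 2 * (u₃ ⬝ᵥ (A *ᵥ u₃) + z₃ ⬝ᵥ (C *ᵥ z₃) + 2 * |κ|) ≤ 8 * R := by linarith
  have hGval : pcoOneG G (A, B, C) (F, w, z) =
      G * (w ⬝ᵥ (A *ᵥ w)) * (z ⬝ᵥ (C *ᵥ z)) - (u₁ ⬝ᵥ (B *ᵥ v₁) + u₂ ⬝ᵥ (B *ᵥ v₂)) ^ 2 := by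
    rw [hY2]; simp only [pcoOneG]
  have hG'val : pcoOneG' G (A, B, C) (field (A, B, C)) (F, w, z) =
      G * ((w ⬝ᵥ ((A * A + B * Bᵀ + (2 : ℝ) • A.sharp) *ᵥ w)) * (z ⬝ᵥ (C *ᵥ z)) +
        (w ⬝ᵥ (A *ᵥ w)) * (z ⬝ᵥ ((C * C + Bᵀ * B + (2 : ℝ) • C.sharp) *ᵥ z))) -
        2 * (kyFanQ B F * kyFanQ (A * B + B * C + (2 : ℝ) • B.sharp) F) := by
    simp only [pcoOneG', field]
    ring
  rw [← hYY] at hG'val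
  have hGle : pcoOneG G (A, B, C) (F, w, z) ≤ 0 := hG0
  have hfin : 8 * R * pcoOneG G (A, B, C) (F, w, z) ≤
      2 * (u₃ ⬝ᵥ (A *ᵥ u₃) + z₃ ⬝ᵥ (C *ᵥ z₃) + 2 * |κ|) * pcoOneG G (A, B, C) (F, w, z) :=
    mul_le_mul_of_nonpos_right hS hGle
  refine hfin.trans ?_
  rw [hGval, hG'val]
  linarith [key]

/-! ### Thm. 7.1 (1), ODE part -/

/-- **Hamilton 1986, Thm. 7.1, inequality (1), ODE part (proved)**: for `0 < m` and `0 < G`,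
`{(b₂ + b₃)² ≤ G a₁ c₁}` is forward invariant under Hamilton's ODE `M' = M² + M#` relative to
`{A, C symmetric} ∩ {a₁ ≥ m} ∩ {c₁ ≥ m}` ("the inequality `(b₂ + b₃)² ≤ G a₁c₁` is preserved for
any constant `G`", p. 171). [cite: Hamilton1986, §7, Thm. 7.1 (1) (pp. 170–171)] -/
theorem hamilton1986_pinchingOne_ode : ∀ m G : ℝ, 0 < m → 0 < G →
    IsInvariantRel field
      (fun _ ↦ {p : Blocks | (p.1.IsSymm ∧ p.2.2.IsSymm) ∧ p.1.SmallestEigenvalueAddNonneg (-m) ∧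
        p.2.2.SmallestEigenvalueAddNonneg (-m)})
      (fun _ ↦ {p | SingularValuesSumSqLEMinProd p G}) := by
  intro m G hm hG γ t₀ t₁ _ h₁ hγ hK hin
  have hγc := IsSolutionOn.continuousOn hγ
  have hGc := continuousOn_pcoOneG_family G hγc pcoOneSet
  have hG'c := continuousOn_pcoOneG'_family G hγc pcoOneSet
  have hGd : ∀ q ∈ pcoOneSet, ∀ s ∈ Icc t₀ t₁, _root_.HasDerivAt (fun t ↦ pcoOneG G (γ t) q)
      (pcoOneG' G (γ s) (field (γ s)) q) s := fun q _ s hs ↦ hasDerivAt_pcoOneG G (hγ s hs) q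
  -- uniform bound `R` for `Σ|A| + Σ|B| + Σ|C|`
  have hent : ∀ {f : Blocks → Matrix (Fin 3) (Fin 3) ℝ}, Continuous f →
      ContinuousOn (fun t ↦ ∑ k, ∑ l, |f (γ t) k l|) (Icc t₀ t₁) := by
    intro f hf
    have h : ContinuousOn (fun t ↦ f (γ t)) (Icc t₀ t₁) := hf.comp_continuousOn hγc
    exact continuousOn_finsetSum _ fun k _ ↦ continuousOn_finsetSum _ fun l _ ↦
      ((continuousOn_pi.1 (continuousOn_pi.1 h k) l)).abs
  have hScont : ContinuousOn (fun t ↦ (∑ k, ∑ l, |(γ t).1 k l|) + (∑ k, ∑ l, |(γ t).2.1 k l|) +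
      ∑ k, ∑ l, |(γ t).2.2 k l|) (Icc t₀ t₁) :=
    ((hent (f := fun p ↦ p.1) continuous_fst).add
      (hent (f := fun p ↦ p.2.1) (continuous_fst.comp continuous_snd))).add
      (hent (f := fun p ↦ p.2.2) (continuous_snd.comp continuous_snd))
  obtain ⟨sR, -, hR⟩ := isCompact_Icc.exists_isMaxOn (nonempty_Icc.2 h₁) hScont
  set R := (∑ k, ∑ l, |(γ sR).1 k l|) + (∑ k, ∑ l, |(γ sR).2.1 k l|) + ∑ k, ∑ l, |(γ sR).2.2 k l|
    with hRdef
  have hR' : ∀ s ∈ Icc t₀ t₁, (∑ k, ∑ l, |(γ s).1 k l|) + (∑ k, ∑ l, |(γ s).2.1 k l|) +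
      ∑ k, ∑ l, |(γ s).2.2 k l| ≤ R := fun s hs ↦ hR hs
  have hC0 : 0 ≤ 8 * R := by positivity
  have key := minOverSet_nonneg_of_deriv (G := fun t q ↦ pcoOneG G (γ t) q)
    (G' := fun t q ↦ pcoOneG' G (γ t) (field (γ t)) q) isCompact_pcoOneSet pcoOneSet_nonempty
    hGc hGd hG'c h₁ one_pos hC0 (η := 1) (fun s hs q hq hqmin _ hG0 ↦ ?_) ?_
  · rw [mem_setOf_eq, singularValuesSumSqLEMinProd_iff]
    exact (le_minOverSet_iff isCompact_pcoOneSet pcoOneSet_nonempty (continuousOn_slice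
      (G := fun t q ↦ pcoOneG G (γ t) q) hGc (right_mem_Icc.2 h₁)) 0).1 key
  · have hsI : s ∈ Icc t₀ t₁ := Ico_subset_Icc_self hs
    obtain ⟨⟨hA, hC⟩, h1A, h1C⟩ := hK s hsI
    exact pcoOne_sign hG hm hA hC h1A h1C (hR' s hsI) hq hqmin hG0
  · refine (le_minOverSet_iff isCompact_pcoOneSet pcoOneSet_nonempty (continuousOn_slice
      (G := fun t q ↦ pcoOneG G (γ t) q) hGc (left_mem_Icc.2 h₁)) 0).2 ?_
    exact (singularValuesSumSqLEMinProd_iff G (γ t₀)).1 hin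

/-- **Hamilton 1986, Thm. 7.1, inequality (1), relative to `M ≥ m > 0`** — the form used in the
pinching set (`M ≥ 0`, and `M ≥ m`, are themselves preserved: `isInvariant_isSymm_operatorGE`,
`HamiltonODEPositiveCone.lean`; `M ≥ m` gives `a₁, c₁ ≥ m`). [cite: Hamilton1986, §7, Thm. 7.1 (1) (pp. 170–171)] -/
theorem hamilton1986_pinchingOne_ode_of_operatorGE {m G : ℝ} (hm : 0 < m) (hG : 0 < G) :
    IsInvariantRel field
      (fun _ ↦ {p : Blocks | (p.1.IsSymm ∧ p.2.2.IsSymm) ∧ OperatorGE p m})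
      (fun _ ↦ {p | SingularValuesSumSqLEMinProd p G}) :=
  (hamilton1986_pinchingOne_ode m G hm hG).mono_left fun _ _ _ hp ↦
    ⟨hp.1, hp.2.smallestEigenvalueAddNonneg_fst, hp.2.smallestEigenvalueAddNonneg_snd_snd⟩

/-! ### Closedness and the reflection `B ↦ -B` -/

/-- The set `{(b₂ + b₃)² ≤ G a₁ c₁}` is closed. [folklore] -/
theorem isClosed_singularValuesSumSqLEMinProd (G : ℝ) :
    IsClosed {p : Blocks | SingularValuesSumSqLEMinProd p G} := by
  have e : {p : Blocks | SingularValuesSumSqLEMinProd p G} = ⋂ q ∈ pcoOneSet, {p | 0 ≤ pcoOneG G p q} := by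
    ext p; simp only [mem_setOf_eq, singularValuesSumSqLEMinProd_iff, mem_iInter]
  rw [e]
  exact isClosed_biInter fun q _ ↦ isClosed_le continuous_const
    ((continuous_pcoOneG G).comp (continuous_id.prodMk continuous_const))

/-- The set `{(b₂ + b₃)² ≤ G a₁ c₁}` is invariant under the reflection `B ↦ -B` (so the
statement is insensitive to the sign convention of the `B^#` term, cf. `IsInvariantRel.reflect`).
[folklore] -/
theorem SingularValuesSumSqLEMinProd.reflectB {p : Blocks} {G : ℝ} (h : SingularValuesSumSqLEMinProd p G) :
    SingularValuesSumSqLEMinProd (reflectB p) G := by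
  intro u₁ u₂ v₁ v₂ w z hu₁ hu₂ hu hv₁ hv₂ hv hw hz
  have := h u₁ u₂ v₁ v₂ w z hu₁ hu₂ hu hv₁ hv₂ hv hw hz
  simp only [HamiltonODE.reflectB, Matrix.neg_mulVec, dotProduct_neg]
  nlinarith

end HamiltonODE

end Literature.Geometry.Riemannian

end
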